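import Summits.HubbardSuperconductivity.HubbardSuperconductivity.Theorems.AnisotropyChordTransferFibre3TwoHoleBSCovariance
import Summits.HubbardSuperconductivity.HubbardSuperconductivity.Theorems.AnisotropyChordTransferFibre3Hole2Check

/-!
# Route `AnisotropyChord` / H0 rotor rung: HOLE₂ by the BOND Birman–Schwinger formulation — I: the channel bound at one hole

First half of the «theorem of channels» (`…Fibre3Hole2BondGap.twoHoleGap_of_channels`: for `2 ≤ L`, `0 < g < ε₁`,
`aKer L (2g) (2,0) ≤ ½` and `2·aKer L (2g) (1,1) − aKer L (2g) (2,0) ≤ ½` ⇒ `TwoHoleGap L g`, EVERY pair, every `L`).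

Idea (bond charges instead of site capacities).  Removing the two sites deletes ≤ 8 bonds; with `B = ½Σ_b δ_bδ_bᵀ`
(`δ_b = e_x − e_y`, a ZERO-SUM charge, so the constant mode and the logarithmic capacity never enter) HOLE₂(g) says that the
`8 × 8` Gram matrix `M = ½(δ_bᵀ(A−g)⁻¹δ_{b'})` has at most two eigenvalues above `1` — and the two isolated hole sites force
two.  By Weyl, `λ₃(S₁+S₂) ≤ λ₂(S₁) + λ₂(S₂)`, so it suffices that the SECOND eigenvalue of each one-hole `4 × 4` block is
`≤ ½`; by the `C₄ᵥ` symmetry of the cross that block splits into the channels `s | p,p | d` with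
`μ_p = aKer(2,0)`, `μ_d = 2aKer(1,1) − aKer(2,0)` (KT units, `λ = 2g`).  This file is the one-hole half of the variational
transcript (no spectral theory): p2 g2's Legendre bound `dual_bound` with the `p,p,d` charges of a cross (pairwise
`Γ`-orthogonal by the lattice symmetries, p2's `greenW_negArg/greenW_swap/greenW_mirror`) and the four-point Parseval identity give
★ `channel_bound`: if `Σf = 0` and the `s`-flux `Σ_e (f z − f(z+e))` vanishes, then `½Σ_e‖f z − f(z+e)‖² ≤ ½(E[f] − g‖f‖²)`.
The dimension count over the pair and `TwoHoleGap` itself are in `…Hole2BondGap`; this file also DECLARES the objects used there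
(`guardSum` = the guarded bond sum of `TwoHoleGap`, the family `fam` = `v₀δ_{z₁} + v₁δ_{z₂} − (v₀+v₁)/(V−2)·1_{∉ζ} + v₂φ` and its
flux map `fluxMap : ℂ³ →ₗ ℂ²`) and the per-`L` CHANNEL CHECKER `Hole2.chanCheck L : Bool` (g3's `checkParams` + two integer
comparisons of g3's Green enclosures `greenIv` at `(0,0),(2,0),(1,1)`; soundness in `…Fibre3Hole2Chan`), so that every later
file of the chain is definition-free.
Numerics (prover's scratch, pure python; brute-force `gap₂/ε₁ = .7369/.7735/.8053/.8552` at `L = 8/9/10/12` = PartN36 table):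
at `g = ¾ε₁`, `aKer(2,0) = .578 .544 .518 .496 .479 … → 1 − 2/π = .363` (`L = 8 9 10 11 12 …`), so the first hypothesis holds
from `L = 11` on and the second always (`≤ .341`).
Prover seat `hubbard-h0-rotor-p3` g4; helper for stmt-HubbardSuperconductivity-19089 (`--supports`, helper class).
WHAT THIS IS NOT: nothing here proves superconductivity in the Hubbard model (rotor TARGET as worded stays FALSE, g15 verdict);
a lemma toward ONE hypothesis (HOLE₂) of ONE conditional reduction (rung 19089). Tree imports only; no sorry, no axioms.
-/

set_option linter.dupNamespace false
set_option autoImplicit false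

noncomputable section

open scoped BigOperators
open Complex Finset

namespace Summit.HubbardSuperconductivity.HubbardSuperconductivity.Theorems.AnisotropyChord.Transfer.Fibre3

namespace TwoHoleBS

variable (L : ℕ) [NeZero L]

/-! ## The Green's function at the needed differences (walk units, `λ = 2g`) -/

/-- `G̃_g` is the real number `2·Gres L (2g) r`. [folklore] -/
theorem greenW_eq_ofReal (g : ℝ) (r : Tor L) : greenW L g r = ((2 * Gres L (2 * g) r : ℝ) : ℂ) := by
  apply Complex.ext
  · rw [greenW_re, Complex.ofReal_re]
  · rw [greenW_im, Complex.ofReal_im]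

/-- `G̃(2e_y) = G̃(2eₓ)` (p2's `greenW_swap`). [folklore] -/
theorem greenW_two_ey (g : ℝ) : greenW L g (ey L + ey L) = greenW L g (ex L + ex L) := by
  have : (ey L + ey L : Tor L) = ((ex L + ex L).2, (ex L + ex L).1) := by
    unfold ex ey; ext <;> simp
  rw [this, greenW_swap]

/-- `G̃(eₓ − e_y) = G̃(eₓ + e_y)` (p2's `greenW_mirror` and `greenW_negArg`). [folklore] -/
theorem greenW_ex_sub_ey (g : ℝ) : greenW L g (ex L - ey L) = greenW L g (ex L + ey L) := by
  have h1 : (-(ex L + ey L) : Tor L) = (-(ex L - ey L).1, (ex L - ey L).2) := by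
    unfold ex ey; ext <;> simp
  rw [← greenW_negArg L g (ex L + ey L), h1, greenW_mirror]

/-- `G̃(0) = 2·Gres L (2g) 0` and `G̃(r) = G̃(0) − 2·aKer L (2g) r` as complex numbers. [folklore] -/
theorem greenW_eq_zero_sub (g : ℝ) (r : Tor L) :
    greenW L g r = ((2 * Gres L (2 * g) 0 - 2 * aKer L (2 * g) r : ℝ) : ℂ) := by
  rw [greenW_eq_ofReal]; unfold aKer; push_cast; ring

/-! ## Charges carried by four lattice points -/

/-- the lattice charge `Σ_p γ_p δ_{q_p}` carried by four points. [folklore] -/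
def charge4 (q : Fin 4 → Tor L) (γ : Fin 4 → ℂ) : Tor L → ℂ :=
  fun x => ∑ p : Fin 4, if q p = x then γ p else 0

/-- pairing a carried charge with a lattice function. [folklore] -/
theorem sum_conj_charge4_mul (q : Fin 4 → Tor L) (γ : Fin 4 → ℂ) (F : Tor L → ℂ) :
    ∑ x : Tor L, (starRingEnd ℂ) (charge4 L q γ x) * F x = ∑ p : Fin 4, (starRingEnd ℂ) (γ p) * F (q p) := by
  unfold charge4
  simp_rw [map_sum, Finset.sum_mul]
  rw [Finset.sum_comm]
  refine Finset.sum_congr rfl fun p _ => ?_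
  simp_rw [apply_ite (starRingEnd ℂ), map_zero, ite_mul, zero_mul]
  rw [Finset.sum_ite_eq]
  simp

/-- pairing a lattice function with a carried charge. [folklore] -/
theorem sum_mul_charge4 (q : Fin 4 → Tor L) (γ : Fin 4 → ℂ) (F : Tor L → ℂ) :
    ∑ y : Tor L, F y * charge4 L q γ y = ∑ p : Fin 4, F (q p) * γ p := by
  unfold charge4
  simp_rw [Finset.mul_sum]
  rw [Finset.sum_comm]
  refine Finset.sum_congr rfl fun p _ => ?_
  simp_rw [mul_ite, mul_zero]
  rw [Finset.sum_ite_eq]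
  simp

/-- the Green quadratic form of a carried charge is the `4 × 4` Green-matrix form. [folklore] -/
theorem greenQF_charge4 (g : ℝ) (q : Fin 4 → Tor L) (γ : Fin 4 → ℂ) :
    greenQF L g (charge4 L q γ)
      = ∑ p : Fin 4, ∑ p' : Fin 4, (starRingEnd ℂ) (γ p) * greenW L g (q p - q p') * γ p' := by
  unfold greenQF
  have h1 : ∀ x : Tor L, ∑ y : Tor L, (starRingEnd ℂ) (charge4 L q γ x) * greenW L g (x - y) * charge4 L q γ y
      = (starRingEnd ℂ) (charge4 L q γ x) * ∑ p' : Fin 4, greenW L g (x - q p') * γ p' := by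
    intro x
    rw [← sum_mul_charge4 L q γ (fun y => greenW L g (x - y)), Finset.mul_sum]
    exact Finset.sum_congr rfl fun y _ => by rw [mul_assoc]
  rw [Finset.sum_congr rfl fun x _ => h1 x,
    sum_conj_charge4_mul L q γ (fun x => ∑ p' : Fin 4, greenW L g (x - q p') * γ p')]
  refine Finset.sum_congr rfl fun p _ => ?_
  rw [Finset.mul_sum]
  refine Finset.sum_congr rfl fun p' _ => ?_
  rw [mul_assoc]

/-! ## The cross of a hole: boundary points, the `p,p,d` charges, the four-point Parseval identity -/

/-- the four boundary points of the hole `z`: `z + eₓ, z − eₓ, z + e_y, z − e_y`. [folklore] -/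
def crossPt (z : Tor L) : Fin 4 → Tor L := ![z + ex L, z - ex L, z + ey L, z - ey L]

/-- weights of the charge `t₁·w_{p₁} + t₂·w_{p₂} + t₃·w_d` on the cross
(`w_{p₁} = δ_{z−eₓ} − δ_{z+eₓ}`, `w_{p₂} = δ_{z−e_y} − δ_{z+e_y}`, `w_d = −δ_{z+eₓ} − δ_{z−eₓ} + δ_{z+e_y} + δ_{z−e_y}`). [folklore] -/
def chanWt (t₁ t₂ t₃ : ℂ) : Fin 4 → ℂ := ![-t₁ - t₃, t₁ - t₃, -t₂ + t₃, t₂ + t₃]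

/-- bond mass of `f` at the site `z`: `Σ_e ‖f z − f(z+e)‖²` (for `f z = 0` this is `nbr L f z`). [folklore] -/
def bmass (f : Tor L → ℂ) (z : Tor L) : ℝ := ((nnList L).map fun e => ‖f z - f (z + e)‖ ^ 2).sum

/-- `s`-channel flux of `f` at `z`: `Σ_e (f z − f(z+e))`. [folklore] -/
def sflux (f : Tor L → ℂ) (z : Tor L) : ℂ :=
  (f z - f (z + ex L)) + (f z - f (z - ex L)) + (f z - f (z + ey L)) + (f z - f (z - ey L))

/-- the Legendre functional `Q_g(f) = E[f] − g‖f‖²`. [folklore] -/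
def Qf (g : ℝ) (f : Tor L → ℂ) : ℝ := dirichletW L f - g * ∑ x : Tor L, ‖f x‖ ^ 2

omit [NeZero L] in
/-- the bond mass written out over the four directions. [folklore] -/
theorem bmass_four (f : Tor L → ℂ) (z : Tor L) :
    bmass L f z = ‖f z - f (z + ex L)‖ ^ 2 + ‖f z - f (z - ex L)‖ ^ 2 + ‖f z - f (z + ey L)‖ ^ 2
      + ‖f z - f (z - ey L)‖ ^ 2 := by
  unfold bmass
  rw [nnList_map_sum, ← sub_eq_add_neg, ← sub_eq_add_neg]

omit [NeZero L] in
/-- for `f z = 0` the bond mass is the boundary mass `nbr`. [folklore] -/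
theorem bmass_eq_nbr {f : Tor L → ℂ} {z : Tor L} (h : f z = 0) : bmass L f z = nbr L f z := by
  unfold bmass nbr; simp [h]

/-- four-point Parseval: `Σ‖x_i‖² = ‖Σx‖²/4 + ‖x₁−x₂‖²/2 + ‖x₃−x₄‖²/2 + ‖x₁+x₂−x₃−x₄‖²/4`. [folklore] -/
theorem parseval4 (x₁ x₂ x₃ x₄ : ℂ) :
    ‖x₁‖ ^ 2 + ‖x₂‖ ^ 2 + ‖x₃‖ ^ 2 + ‖x₄‖ ^ 2
      = ‖x₁ + x₂ + x₃ + x₄‖ ^ 2 / 4 + ‖x₁ - x₂‖ ^ 2 / 2 + ‖x₃ - x₄‖ ^ 2 / 2 + ‖x₁ + x₂ - x₃ - x₄‖ ^ 2 / 4 := by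
  simp only [Complex.sq_norm, Complex.normSq_apply, Complex.add_re, Complex.add_im, Complex.sub_re, Complex.sub_im]
  ring

/-- `Re(conj(κ w) · w) = κ‖w‖²` for real `κ`. [folklore] -/
theorem re_conj_smul_mul (κ : ℝ) (w : ℂ) : ((starRingEnd ℂ) ((κ : ℂ) * w) * w).re = κ * ‖w‖ ^ 2 := by
  rw [map_mul, Complex.conj_ofReal, mul_assoc, Complex.re_ofReal_mul, Complex.sq_norm]
  congr 1
  rw [← Complex.normSq_eq_conj_mul_self, Complex.ofReal_re]

/-- ★ CHANNEL BOUND at one hole: if `Σf = 0` and the `s`-flux of `f` at `z` vanishes, then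
`½·Σ_e‖f z − f(z+e)‖² ≤ ½·Q_g(f)` provided `aKer(2,0) ≤ ½` and `2aKer(1,1) − aKer(2,0) ≤ ½` (at `λ = 2g`, `g < ε₁`).
[Four-point Parseval: the mass is `‖p₁‖²/4 + ‖p₂‖²/4 + ‖d‖²/8`; Legendre bound with the charge `½p₁w_{p₁} + ½p₂w_{p₂} + ¼dw_d`,
whose Green form is diagonal in the channels with `Γ(w_p) = 4aKer(2,0)`, `Γ(w_d) = 16aKer(1,1) − 8aKer(2,0)`.] [folklore] -/
theorem channel_bound (hL : 2 ≤ L) {g : ℝ} (hg : g < eps1 L)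
    (h1 : aKer L (2 * g) (ex L + ex L) ≤ 1 / 2)
    (h2 : 2 * aKer L (2 * g) (ex L + ey L) - aKer L (2 * g) (ex L + ex L) ≤ 1 / 2)
    (f : Tor L → ℂ) (hf : ∑ x : Tor L, f x = 0) (z : Tor L) (hs : sflux L f z = 0) :
    (1 / 2 : ℝ) * bmass L f z ≤ (1 / 2 : ℝ) * Qf L g f := by
  -- the four boundary values as atoms
  set u₁ : ℂ := f (z + ex L) with hu₁
  set u₂ : ℂ := f (z - ex L) with hu₂
  set u₃ : ℂ := f (z + ey L) with hu₃
  set u₄ : ℂ := f (z - ey L) with hu₄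
  -- the three channel amplitudes
  set P₁ : ℂ := u₂ - u₁ with hP₁
  set P₂ : ℂ := u₄ - u₃ with hP₂
  set Dd : ℂ := -u₁ - u₂ + u₃ + u₄ with hDd
  -- four-point Parseval with vanishing flux
  have hmass : bmass L f z = ‖P₁‖ ^ 2 / 2 + ‖P₂‖ ^ 2 / 2 + ‖Dd‖ ^ 2 / 4 := by
    rw [bmass_four]
    have hP := parseval4 (f z - u₁) (f z - u₂) (f z - u₃) (f z - u₄)
    have hs' : f z - u₁ + (f z - u₂) + (f z - u₃) + (f z - u₄) = 0 := hs
    rw [hs'] at hP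
    have e1 : f z - u₁ - (f z - u₂) = P₁ := by rw [hP₁]; ring
    have e2 : f z - u₃ - (f z - u₄) = P₂ := by rw [hP₂]; ring
    have e3 : f z - u₁ + (f z - u₂) - (f z - u₃) - (f z - u₄) = Dd := by rw [hDd]; ring
    rw [e1, e2, e3, norm_zero] at hP
    linarith
  -- the charge and the Legendre bound
  set γ : Fin 4 → ℂ := chanWt (((1 / 2 : ℝ) : ℂ) * P₁) (((1 / 2 : ℝ) : ℂ) * P₂) (((1 / 4 : ℝ) : ℂ) * Dd) with hγ
  have hdual := dual_bound L hL hg f (charge4 L (crossPt L z) γ) hf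
  -- the pairing `⟨c, f⟩`
  have hpair : (∑ x : Tor L, (starRingEnd ℂ) (charge4 L (crossPt L z) γ x) * f x).re
      = ‖P₁‖ ^ 2 / 2 + ‖P₂‖ ^ 2 / 2 + ‖Dd‖ ^ 2 / 4 := by
    rw [sum_conj_charge4_mul, Fin.sum_univ_four]
    simp only [hγ, chanWt, crossPt, Matrix.cons_val_zero, Matrix.cons_val_one, Matrix.head_cons,
      Matrix.cons_val_two, Matrix.tail_cons, Matrix.cons_val_three]
    rw [← hu₁, ← hu₂, ← hu₃, ← hu₄]
    have : (starRingEnd ℂ) (-(((1 / 2 : ℝ) : ℂ) * P₁) - ((1 / 4 : ℝ) : ℂ) * Dd) * u₁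
        + (starRingEnd ℂ) (((1 / 2 : ℝ) : ℂ) * P₁ - ((1 / 4 : ℝ) : ℂ) * Dd) * u₂
        + (starRingEnd ℂ) (-(((1 / 2 : ℝ) : ℂ) * P₂) + ((1 / 4 : ℝ) : ℂ) * Dd) * u₃
        + (starRingEnd ℂ) (((1 / 2 : ℝ) : ℂ) * P₂ + ((1 / 4 : ℝ) : ℂ) * Dd) * u₄
        = (starRingEnd ℂ) (((1 / 2 : ℝ) : ℂ) * P₁) * P₁ + (starRingEnd ℂ) (((1 / 2 : ℝ) : ℂ) * P₂) * P₂
          + (starRingEnd ℂ) (((1 / 4 : ℝ) : ℂ) * Dd) * Dd := by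
      simp only [map_sub, map_neg, map_add, map_mul, Complex.conj_ofReal]
      rw [hP₁, hP₂, hDd]
      ring
    rw [this, Complex.add_re, Complex.add_re, re_conj_smul_mul, re_conj_smul_mul, re_conj_smul_mul]
    ring
  -- the Green form of the charge: diagonal in the channels
  have hqf : (greenQF L g (charge4 L (crossPt L z) γ)).re
      = aKer L (2 * g) (ex L + ex L) * (‖P₁‖ ^ 2 + ‖P₂‖ ^ 2)
        + (aKer L (2 * g) (ex L + ey L) - aKer L (2 * g) (ex L + ex L) / 2) * ‖Dd‖ ^ 2 := by
    rw [greenQF_charge4, Fin.sum_univ_four, Fin.sum_univ_four, Fin.sum_univ_four, Fin.sum_univ_four,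
      Fin.sum_univ_four]
    simp only [hγ, chanWt, crossPt, Matrix.cons_val_zero, Matrix.cons_val_one, Matrix.head_cons,
      Matrix.cons_val_two, Matrix.tail_cons, Matrix.cons_val_three]
    -- normalise the sixteen differences
    have d11 : z + ex L - (z + ex L) = (0 : Tor L) := by abel
    have d22 : z - ex L - (z - ex L) = (0 : Tor L) := by abel
    have d33 : z + ey L - (z + ey L) = (0 : Tor L) := by abel
    have d44 : z - ey L - (z - ey L) = (0 : Tor L) := by abel
    have d12 : z + ex L - (z - ex L) = ex L + ex L := by abel
    have d21 : z - ex L - (z + ex L) = -(ex L + ex L) := by abel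
    have d34 : z + ey L - (z - ey L) = ey L + ey L := by abel
    have d43 : z - ey L - (z + ey L) = -(ey L + ey L) := by abel
    have d13 : z + ex L - (z + ey L) = ex L - ey L := by abel
    have d31 : z + ey L - (z + ex L) = -(ex L - ey L) := by abel
    have d14 : z + ex L - (z - ey L) = ex L + ey L := by abel
    have d41 : z - ey L - (z + ex L) = -(ex L + ey L) := by abel
    have d23 : z - ex L - (z + ey L) = -(ex L + ey L) := by abel
    have d32 : z + ey L - (z - ex L) = ex L + ey L := by abel
    have d24 : z - ex L - (z - ey L) = -(ex L - ey L) := by abel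
    have d42 : z - ey L - (z - ex L) = ex L - ey L := by abel
    rw [d11, d22, d33, d44, d12, d21, d34, d43, d13, d31, d14, d41, d23, d32, d24, d42]
    simp only [greenW_negArg]
    rw [greenW_two_ey L g, greenW_ex_sub_ey L g, greenW_eq_zero_sub L g (ex L + ex L),
      greenW_eq_zero_sub L g (ex L + ey L), greenW_eq_ofReal L g 0]
    set G0 : ℝ := Gres L (2 * g) 0 with hG0
    set a : ℝ := aKer L (2 * g) (ex L + ex L) with ha'
    set b : ℝ := aKer L (2 * g) (ex L + ey L) with hb'
    simp only [map_sub, map_neg, map_add, map_mul, Complex.conj_ofReal, Complex.add_re, Complex.sub_re,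
      Complex.neg_re, Complex.mul_re, Complex.conj_re, Complex.conj_im, Complex.ofReal_re, Complex.ofReal_im,
      Complex.neg_im, Complex.add_im, Complex.sub_im, Complex.mul_im, Complex.sq_norm, Complex.normSq_apply]
    ring
  -- assemble
  have hQ : (1 - aKer L (2 * g) (ex L + ex L)) * (‖P₁‖ ^ 2 + ‖P₂‖ ^ 2)
      + (1 / 2 - (aKer L (2 * g) (ex L + ey L) - aKer L (2 * g) (ex L + ex L) / 2)) * ‖Dd‖ ^ 2 ≤ Qf L g f := by
    unfold Qf
    have := hdual
    rw [hpair, hqf] at this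
    linarith
  have hP1 : 0 ≤ ‖P₁‖ ^ 2 + ‖P₂‖ ^ 2 := by positivity
  have hD : 0 ≤ ‖Dd‖ ^ 2 := by positivity
  rw [hmass]
  nlinarith [mul_le_mul_of_nonneg_right h1 hP1, mul_le_mul_of_nonneg_right h2 hD]

/-! ## Objects of the two-hole argument (used in `…Hole2BondGap`): the guarded sum and the three-parameter family -/

/-- the guarded bond sum of `TwoHoleGap` (four times the two-hole Dirichlet form). [folklore] -/
def guardSum (z₁ z₂ : Tor L) (f : Tor L → ℂ) : ℝ :=
  ∑ x : Tor L, ((nnList L).map (fun e =>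
    if (x = z₁ ∨ x = z₂ ∨ x + e = z₁ ∨ x + e = z₂) then (0 : ℝ) else ‖f x - f (x + e)‖ ^ 2)).sum

/-! ## The family `f_v = v₀δ_{z₁} + v₁δ_{z₂} − (v₀+v₁)/(V−2)·1_{∉ζ} + v₂φ` -/

/-- the three-parameter family of test functions. [folklore] -/
def fam (z₁ z₂ : Tor L) (φ : Tor L → ℂ) (v : Fin 3 → ℂ) : Tor L → ℂ := fun x =>
  v 0 * (if x = z₁ then 1 else 0) + v 1 * (if x = z₂ then 1 else 0)
    + (-(v 0 + v 1) / ((L : ℂ) ^ 2 - 2)) * (if (x = z₁ ∨ x = z₂) then 0 else 1) + v 2 * φ x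

omit [NeZero L] in
/-- the family is additive in `v`. [folklore] -/
theorem fam_add (z₁ z₂ : Tor L) (φ : Tor L → ℂ) (v w : Fin 3 → ℂ) :
    fam L z₁ z₂ φ (v + w) = fam L z₁ z₂ φ v + fam L z₁ z₂ φ w := by
  funext x; simp only [fam, Pi.add_apply]; ring

omit [NeZero L] in
/-- the family is homogeneous in `v`. [folklore] -/
theorem fam_smul (z₁ z₂ : Tor L) (φ : Tor L → ℂ) (c : ℂ) (v : Fin 3 → ℂ) :
    fam L z₁ z₂ φ (c • v) = c • fam L z₁ z₂ φ v := by
  funext x; simp only [fam, Pi.smul_apply, smul_eq_mul]; ring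

omit [NeZero L] in
/-- the `s`-flux is additive. [folklore] -/
theorem sflux_add (f₁ f₂ : Tor L → ℂ) (z : Tor L) : sflux L (f₁ + f₂) z = sflux L f₁ z + sflux L f₂ z := by
  simp only [sflux, Pi.add_apply]; ring

omit [NeZero L] in
/-- the `s`-flux is homogeneous. [folklore] -/
theorem sflux_smul (c : ℂ) (f : Tor L → ℂ) (z : Tor L) : sflux L (c • f) z = c * sflux L f z := by
  simp only [sflux, Pi.smul_apply, smul_eq_mul]; ring

/-- the two `s`-fluxes of the family, a `ℂ`-linear map `ℂ³ → ℂ²`. [folklore] -/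
def fluxMap (z₁ z₂ : Tor L) (φ : Tor L → ℂ) : (Fin 3 → ℂ) →ₗ[ℂ] (Fin 2 → ℂ) where
  toFun v := ![sflux L (fam L z₁ z₂ φ v) z₁, sflux L (fam L z₁ z₂ φ v) z₂]
  map_add' v w := by
    ext i
    fin_cases i <;> simp [fam_add, sflux_add]
  map_smul' c v := by
    ext i
    fin_cases i <;> simp [fam_smul, sflux_smul]


end TwoHoleBS


end Summit.HubbardSuperconductivity.HubbardSuperconductivity.Theorems.AnisotropyChord.Transfer.Fibre3

end

/- the checker lives outside the `noncomputable section` (it is evaluated by the kernel via `decide`) -/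

namespace Summit.HubbardSuperconductivity.HubbardSuperconductivity.Theorems.AnisotropyChord.Transfer.Fibre3

/-! ## The per-`L` channel checker (three Green values; soundness in `…Fibre3Hole2Chan`) -/

namespace Hole2

/-- the channel test given the shared tables: `hi G̃(0,0) − lo G̃(2,0) ≤ D` and `hi G̃(0,0) − 2lo G̃(1,1) + hi G̃(2,0) ≤ D`. [folklore] -/
def chanCheckWith (L : ℕ) (ct : List Iv) (et : List (List Iv)) : Bool :=
  decide ((greenIv L ct et 0 0).2 - (greenIv L ct et 2 0).1 ≤ D)
    && decide ((greenIv L ct et 0 0).2 - 2 * (greenIv L ct et 1 1).1 + (greenIv L ct et 2 0).2 ≤ D)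

/-- ★ the per-`L` channel certificate: parameters sane (g3's `checkParams`) and the two channel inequalities at `g_L`. [folklore] -/
def chanCheck (L : ℕ) : Bool :=
  checkParams L && chanCheckWith L (cosTab L) (einvTab L (cosTab L) (gFix L))


end Hole2

end Summit.HubbardSuperconductivity.HubbardSuperconductivity.Theorems.AnisotropyChord.Transfer.Fibre3
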